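import Literature.RepresentationTheory.BorelWallach2000.UpqMaximalCompactExp
import Literature.Analysis.Matrix.DetExp
import Summits.HodgeConjecture.HodgeConjecture.Theorems.F0P3bSymPowerCalculus
import Mathlib.Analysis.Calculus.Deriv.ZPow
import HarnessLib

/-!
# `K`-type calculus for `U(2,1)`: the matrix coefficients `det(k₁₁)^a · u(k)^b · Sym^n(k₁₁)` of `K = U(2) × U(1)`,
# their continuity, multiplicativity and derivative along `exp tX`, `X ∈ 𝔨`

Route `F0_ThetaPinDelta`, line `F0_LocalAPackets`, stub `StubT3aRealisationDatum`, waypoint **W1** (`K`-integration of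
Kovačević's ladder module; lead A-p03 (g17), brief (k3) of F0P3b-plan (g5)).  Namespace
`Summit.HodgeConjecture.HodgeConjecture.Cruxes.H413.F0P3bKTypeCalculus`.  Two honest definitions (`upqKTypeCoeff`, the
`MonoidHom` `upqKTypeHom`) and theorems; no instance, no notation, no named fact, no `sorry`.  Kovačević-free.

For `k ∈ K = (uFormGroup (Fin 2) (Fin 1)).maximalCompact` with blocks `k₁₁ = upqKBlock₁ k ∈ U(2)`, `k₂₂ = upqKBlock₂ k ∈ U(1)`
(★ `BorelWallach2000/UpqMaximalCompactBlocks`), the `K`-types of the cohomological `U(2,1)`-modules are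
`det(k₁₁)^a ⊗ u^b ⊗ Sym^n(k₁₁)` (`u = (k₂₂)₀₀`); in the monomial basis of ★ `SL2Sym.symPowerMat` their matrix coefficients are
`upqKTypeCoeff n a b k = (det k₁₁ ^ a * u ^ b) • symPowerMat n k₁₁`.  We prove what the `(𝔤, K)`-module axioms
`IsGKModule.weaklyContinuous` / `hasWeakDeriv` consume (Borel–Wallach 0 §2.5; the `K`-types of the ladder representations of
`U(2,1)`: Wallach, and Kovačević §6, `V_{n,3n−3} ≅ Sym^{n−1} ⊗ u^{1−n}`):

* §1 (generic `U(α, β)`): `𝔨` in blocks — `X ∈ 𝔨` is `diag(X₁₁, X₂₂)` with skew-Hermitian blocks (`coe_compactLie_eq_fromBlocks`),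
  `expK (tX) = diag(exp tX₁₁, exp tX₂₂)` (`coe_expK_smul_eq_fromBlocks`, from ★ `coe_expK_fromBlocks`), hence
  `upqKBlock₁ (expK tX) = exp (t X₁₁)`, `upqKBlock₂ (expK tX) = exp (t X₂₂)`;
* §2 `upqKTypeCoeff_one`, `upqKTypeCoeff_mul` (★ `symPowerMat_mul`), the homomorphism `upqKTypeHom`;
  `continuous_upqKTypeCoeff_apply` (★ `continuous_upqKBlock₁/₂`, ★ β1 `continuous_symPowerMat`, `zpow` away from `0`);
* §3 **`hasDerivAt_upqKTypeCoeff_expK`**: for `X ∈ 𝔨`,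
  `d/dt|₀ upqKTypeCoeff n a b (expK tX) i j = (a·tr X₁₁ + b·(X₂₂)₀₀) δ_{ij} + dSymPowerMat n X₁₁ i j`
  (★ β1 `hasDerivAt_symPowerMat_exp_apply`, ★ `Literature.Analysis.Matrix.hasDerivAt_det_exp_smul_zero` (Jacobi at `1`)).

[cite: BorelWallach2000, 0 §2.5; VI §4 4.7–4.8] [cite: Kovacevic2021, §6] [cite: Knapp2002, I §1 Example (3)]
-/

noncomputable section

open scoped MatrixGroups Matrix

namespace Summit.HodgeConjecture.HodgeConjecture.Cruxes.H413.F0P3bKTypeCalculus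

open Literature.NumberTheory.Automorphic
open Literature.RepresentationTheory.BorelWallach2000
open Literature.RepresentationTheory.KonnoKonno2007 Literature.RepresentationTheory.KonnoKonno2007.RealDualPair
open Literature.RepresentationTheory.KonnoKonno2007.RealDualPair.UForm
open Literature.RepresentationTheory.AlgebraicGroups.SL2Sym
open Summit.HodgeConjecture.HodgeConjecture.Cruxes.H413.F0P3bSymPowerDerivation
open Summit.HodgeConjecture.HodgeConjecture.Cruxes.H413.F0P3bSymPowerCalculus

set_option autoImplicit false
set_option linter.dupNamespace false

/-! ## §1 `𝔨 = 𝔲(α) ⊕ 𝔲(β)` and `exp` on it, in blocks (generic `U(α, β)`) -/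

section Blocks

variable {α β : Type*} [Fintype α] [DecidableEq α] [Fintype β] [DecidableEq β]

/-- **`𝔨` in blocks**: `X ∈ 𝔨 = 𝔲(α,β) ∩ 𝔲(α ⊕ β)` has vanishing off-diagonal blocks and skew-Hermitian diagonal blocks
(`X₂₁ = X₁₂ᴴ` from `𝔲(α,β)` and `X₂₁ = −X₁₂ᴴ` from `𝔲(α ⊕ β)`). [cite: Knapp2002, I §1 Example (3)] -/
theorem compactLie_blocks (X : (uFormGroup α β).compactLie) :
    (X : Matrix (α ⊕ β) (α ⊕ β) ℂ).toBlocks₁₂ = 0 ∧ (X : Matrix (α ⊕ β) (α ⊕ β) ℂ).toBlocks₂₁ = 0 ∧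
      ((X : Matrix (α ⊕ β) (α ⊕ β) ℂ).toBlocks₁₁)ᴴ = -(X : Matrix (α ⊕ β) (α ⊕ β) ℂ).toBlocks₁₁ ∧
      ((X : Matrix (α ⊕ β) (α ⊕ β) ℂ).toBlocks₂₂)ᴴ = -(X : Matrix (α ⊕ β) (α ⊕ β) ℂ).toBlocks₂₂ := by
  obtain ⟨hlie, hskew⟩ := (RealMatrixGroup.mem_compactLie_iff _ _).mp X.2
  set M := (X : Matrix (α ⊕ β) (α ⊕ β) ℂ) with hM
  rw [← Matrix.fromBlocks_toBlocks M] at hlie hskew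
  obtain ⟨h11, h22, h21⟩ := (upq_fromBlocks_mem_lie_iff _ _ _ _).mp hlie
  rw [Matrix.star_eq_conjTranspose, Matrix.fromBlocks_conjTranspose, Matrix.fromBlocks_neg,
    Matrix.fromBlocks_inj] at hskew
  obtain ⟨-, h12', h21', -⟩ := hskew
  -- `X₂₁ = X₁₂ᴴ` and `X₂₁ᴴ = -X₁₂` give `X₁₂ = 0`
  have h12 : M.toBlocks₁₂ = 0 := by
    have e : M.toBlocks₂₁ᴴ = M.toBlocks₁₂ := by rw [h21, Matrix.conjTranspose_conjTranspose]
    have h : M.toBlocks₁₂ = -M.toBlocks₁₂ := e.symm.trans h12'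
    have h2 : (2 : ℂ) • M.toBlocks₁₂ = 0 := by rw [two_smul]; nth_rw 2 [h]; rw [add_neg_cancel]
    exact (smul_eq_zero.mp h2).resolve_left two_ne_zero
  refine ⟨h12, ?_, h11, h22⟩
  rw [h21, h12, Matrix.conjTranspose_zero]

/-- `X ∈ 𝔨` is block diagonal: `X = diag(X₁₁, X₂₂)`. [cite: Knapp2002, I §1 Example (3)] -/
theorem coe_compactLie_eq_fromBlocks (X : (uFormGroup α β).compactLie) :
    (X : Matrix (α ⊕ β) (α ⊕ β) ℂ) =
      Matrix.fromBlocks (X : Matrix (α ⊕ β) (α ⊕ β) ℂ).toBlocks₁₁ 0 0 (X : Matrix (α ⊕ β) (α ⊕ β) ℂ).toBlocks₂₂ := by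
  obtain ⟨h12, h21, -, -⟩ := compactLie_blocks X
  conv_lhs => rw [← Matrix.fromBlocks_toBlocks (X : Matrix (α ⊕ β) (α ⊕ β) ℂ)]
  rw [h12, h21]

/-- **`exp (tX) = diag(exp tX₁₁, exp tX₂₂)` for `X ∈ 𝔨`**, as matrices. [cite: Knapp2002, I §1 Example (3)] -/
theorem coe_expK_smul_eq_fromBlocks (t : ℝ) (X : (uFormGroup α β).compactLie) :
    ((((uFormGroup α β).expK (t • X) : (uFormGroup α β).maximalCompact) : GL (α ⊕ β) ℂ) : Matrix (α ⊕ β) (α ⊕ β) ℂ) =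
      Matrix.fromBlocks (NormedSpace.exp (t • (X : Matrix (α ⊕ β) (α ⊕ β) ℂ).toBlocks₁₁)) 0 0
        (NormedSpace.exp (t • (X : Matrix (α ⊕ β) (α ⊕ β) ℂ).toBlocks₂₂)) := by
  obtain ⟨-, -, h11, h22⟩ := compactLie_blocks X
  have h11t : (t • (X : Matrix (α ⊕ β) (α ⊕ β) ℂ).toBlocks₁₁)ᴴ = -(t • (X : Matrix (α ⊕ β) (α ⊕ β) ℂ).toBlocks₁₁) := by
    rw [Matrix.conjTranspose_smul, h11, smul_neg]; simp
  have h22t : (t • (X : Matrix (α ⊕ β) (α ⊕ β) ℂ).toBlocks₂₂)ᴴ = -(t • (X : Matrix (α ⊕ β) (α ⊕ β) ℂ).toBlocks₂₂) := by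
    rw [Matrix.conjTranspose_smul, h22, smul_neg]; simp
  have hX : t • X = ⟨Matrix.fromBlocks (t • (X : Matrix (α ⊕ β) (α ⊕ β) ℂ).toBlocks₁₁) 0 0
      (t • (X : Matrix (α ⊕ β) (α ⊕ β) ℂ).toBlocks₂₂), upq_fromBlocks_mem_compactLie h11t h22t⟩ := by
    apply Subtype.ext
    change t • (X : Matrix (α ⊕ β) (α ⊕ β) ℂ) = _
    conv_lhs => rw [coe_compactLie_eq_fromBlocks X]
    rw [Matrix.fromBlocks_smul, smul_zero, smul_zero]
  rw [hX, coe_expK_fromBlocks h11t h22t]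

/-- The `U(α)`-block of `exp (tX)`, `X ∈ 𝔨`, is `exp (t X₁₁)`. [cite: Knapp2002, I §1 Example (3)] -/
theorem coe_upqKBlock₁_expK_smul (t : ℝ) (X : (uFormGroup α β).compactLie) :
    (upqKBlock₁ ((uFormGroup α β).expK (t • X)) : Matrix α α ℂ) =
      NormedSpace.exp (t • (X : Matrix (α ⊕ β) (α ⊕ β) ℂ).toBlocks₁₁) := by
  rw [coe_upqKBlock₁, coe_expK_smul_eq_fromBlocks, Matrix.toBlocks_fromBlocks₁₁]

/-- The `U(β)`-block of `exp (tX)`, `X ∈ 𝔨`, is `exp (t X₂₂)`. [cite: Knapp2002, I §1 Example (3)] -/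
theorem coe_upqKBlock₂_expK_smul (t : ℝ) (X : (uFormGroup α β).compactLie) :
    (upqKBlock₂ ((uFormGroup α β).expK (t • X)) : Matrix β β ℂ) =
      NormedSpace.exp (t • (X : Matrix (α ⊕ β) (α ⊕ β) ℂ).toBlocks₂₂) := by
  rw [coe_upqKBlock₂, coe_expK_smul_eq_fromBlocks, Matrix.toBlocks_fromBlocks₂₂]

/-- A unitary matrix has non-zero determinant. [cite: Knapp2002, I §1 Example (3)] -/
theorem det_ne_zero_of_mem_unitaryGroup {n : Type*} [Fintype n] [DecidableEq n] (u : Matrix.unitaryGroup n ℂ) :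
    (u : Matrix n n ℂ).det ≠ 0 :=
  (Matrix.isUnit_det_of_left_inverse (Matrix.mem_unitaryGroup_iff'.mp u.2)).ne_zero

end Blocks

/-! ## §2 The `K`-type coefficients `det(k₁₁)^a · u^b · Sym^n(k₁₁)` of `K = U(2) × U(1)` -/

section KType

/-- **The matrix coefficients of the `K`-type `det^a ⊗ u^b ⊗ Sym^n` of `K = U(2) × U(1) ⊂ U(2,1)`** in the monomial basis
`X₀^{n−i} X₁^i` of ★ `symPowerMat`: `(det k₁₁ ^ a * (k₂₂)₀₀ ^ b) • Sym^n(k₁₁)` (`zpow` in `ℂ`; both scalars are unit complex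
numbers). [cite: BorelWallach2000, VI §4 4.7–4.8] [cite: Kovacevic2021, §6] -/
def upqKTypeCoeff (n : ℕ) (a b : ℤ) (k : (uFormGroup (Fin 2) (Fin 1)).maximalCompact) :
    Matrix (Fin (n + 1)) (Fin (n + 1)) ℂ :=
  ((upqKBlock₁ k : Matrix (Fin 2) (Fin 2) ℂ).det ^ a * (upqKBlock₂ k : Matrix (Fin 1) (Fin 1) ℂ) 0 0 ^ b) •
    symPowerMat n (upqKBlock₁ k : Matrix (Fin 2) (Fin 2) ℂ)

/-- Unfolding, entrywise. [cite: BorelWallach2000, VI §4 4.7–4.8] -/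
theorem upqKTypeCoeff_apply (n : ℕ) (a b : ℤ) (k : (uFormGroup (Fin 2) (Fin 1)).maximalCompact) (i j : Fin (n + 1)) :
    upqKTypeCoeff n a b k i j =
      (upqKBlock₁ k : Matrix (Fin 2) (Fin 2) ℂ).det ^ a * (upqKBlock₂ k : Matrix (Fin 1) (Fin 1) ℂ) 0 0 ^ b *
        symPowerMat n (upqKBlock₁ k : Matrix (Fin 2) (Fin 2) ℂ) i j := by
  rw [upqKTypeCoeff, Matrix.smul_apply, smul_eq_mul]

/-- The `(0,0)` entry of a product of `1 × 1` matrices. [cite: Knapp2002, I §1 Example (3)] -/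
theorem mul_apply_fin_one (u v : Matrix (Fin 1) (Fin 1) ℂ) : (u * v) 0 0 = u 0 0 * v 0 0 := by
  rw [Matrix.mul_apply, Fin.sum_univ_one]

/-- `upqKTypeCoeff n a b 1 = 1`. [cite: BorelWallach2000, VI §4 4.7–4.8] -/
theorem upqKTypeCoeff_one (n : ℕ) (a b : ℤ) : upqKTypeCoeff n a b 1 = 1 := by
  rw [upqKTypeCoeff, map_one, map_one]
  change ((1 : Matrix (Fin 2) (Fin 2) ℂ).det ^ a * (1 : Matrix (Fin 1) (Fin 1) ℂ) 0 0 ^ b) •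
    symPowerMat n (1 : Matrix (Fin 2) (Fin 2) ℂ) = 1
  rw [Matrix.det_one, one_zpow, Matrix.one_apply_eq, one_zpow, one_mul, one_smul, symPowerMat_one]

/-- **Multiplicativity**: `upqKTypeCoeff n a b (k k') = upqKTypeCoeff n a b k * upqKTypeCoeff n a b k'` (★ `symPowerMat_mul`,
`det` and the `U(1)`-entry are multiplicative). [cite: BorelWallach2000, VI §4 4.7–4.8] -/
theorem upqKTypeCoeff_mul (n : ℕ) (a b : ℤ) (k k' : (uFormGroup (Fin 2) (Fin 1)).maximalCompact) :
    upqKTypeCoeff n a b (k * k') = upqKTypeCoeff n a b k * upqKTypeCoeff n a b k' := by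
  rw [upqKTypeCoeff, upqKTypeCoeff, upqKTypeCoeff, map_mul, map_mul]
  change (((upqKBlock₁ k : Matrix (Fin 2) (Fin 2) ℂ) * (upqKBlock₁ k' : Matrix (Fin 2) (Fin 2) ℂ)).det ^ a *
      ((upqKBlock₂ k : Matrix (Fin 1) (Fin 1) ℂ) * (upqKBlock₂ k' : Matrix (Fin 1) (Fin 1) ℂ)) 0 0 ^ b) •
    symPowerMat n ((upqKBlock₁ k : Matrix (Fin 2) (Fin 2) ℂ) * (upqKBlock₁ k' : Matrix (Fin 2) (Fin 2) ℂ)) = _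
  rw [Matrix.det_mul, mul_apply_fin_one, mul_zpow, mul_zpow, symPowerMat_mul, Matrix.smul_mul, Matrix.mul_smul,
    smul_smul]
  congr 1
  ring

/-- **The `K`-type as a homomorphism** `K →* Matrix (Fin (n+1)) (Fin (n+1)) ℂ`. [cite: BorelWallach2000, VI §4 4.7–4.8] -/
def upqKTypeHom (n : ℕ) (a b : ℤ) : (uFormGroup (Fin 2) (Fin 1)).maximalCompact →* Matrix (Fin (n + 1)) (Fin (n + 1)) ℂ where
  toFun := upqKTypeCoeff n a b
  map_one' := upqKTypeCoeff_one n a b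
  map_mul' := upqKTypeCoeff_mul n a b

/-- Unfolding. [cite: BorelWallach2000, VI §4 4.7–4.8] -/
@[simp] theorem upqKTypeHom_apply (n : ℕ) (a b : ℤ) (k : (uFormGroup (Fin 2) (Fin 1)).maximalCompact) :
    upqKTypeHom n a b k = upqKTypeCoeff n a b k := rfl

/-- **Continuity of the matrix coefficients** `k ↦ upqKTypeCoeff n a b k i j` on `K` (★ `continuous_upqKBlock₁/₂`, ★ β1
`continuous_symPowerMat`; `zpow` is continuous away from `0` and unitary determinants are non-zero).
[cite: BorelWallach2000, 0 §2.5] -/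
theorem continuous_upqKTypeCoeff_apply (n : ℕ) (a b : ℤ) (i j : Fin (n + 1)) :
    Continuous fun k : (uFormGroup (Fin 2) (Fin 1)).maximalCompact ↦ upqKTypeCoeff n a b k i j := by
  simp only [upqKTypeCoeff_apply]
  have h1 : Continuous fun k : (uFormGroup (Fin 2) (Fin 1)).maximalCompact ↦ (upqKBlock₁ k : Matrix (Fin 2) (Fin 2) ℂ) :=
    continuous_subtype_val.comp continuous_upqKBlock₁
  have h2 : Continuous fun k : (uFormGroup (Fin 2) (Fin 1)).maximalCompact ↦ (upqKBlock₂ k : Matrix (Fin 1) (Fin 1) ℂ) :=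
    continuous_subtype_val.comp continuous_upqKBlock₂
  refine ((h1.matrix_det.zpow₀ a fun k ↦ Or.inl (det_ne_zero_of_mem_unitaryGroup _)).mul
    ((h2.matrix_elem 0 0).zpow₀ b fun k ↦ Or.inl ?_)).mul ((continuous_symPowerMat n).comp h1 |>.matrix_elem i j)
  rw [← Matrix.det_fin_one (upqKBlock₂ k : Matrix (Fin 1) (Fin 1) ℂ)]
  exact det_ne_zero_of_mem_unitaryGroup _

end KType

/-! ## §3 The derivative along `exp tX`, `X ∈ 𝔨` -/

section Deriv

/-- `d/dt|₀ det (exp (t Y)) ^ a = a · tr Y` (Jacobi's formula at `1`, ★ `hasDerivAt_det_exp_smul_zero`, and the chain rule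
for `z ↦ z ^ a` at `det (exp 0) = 1`). [cite: Knapp2002, 0 §2 Prop. 0.11 (e)] -/
theorem hasDerivAt_det_exp_smul_zpow {m : Type*} [Fintype m] [DecidableEq m] (Y : Matrix m m ℂ) (a : ℤ) :
    HasDerivAt (fun t : ℝ ↦ (NormedSpace.exp (t • Y)).det ^ a) ((a : ℂ) * Y.trace) 0 := by
  have hdet := Literature.Analysis.Matrix.hasDerivAt_det_exp_smul_zero Y
  have h0 : (NormedSpace.exp ((0 : ℝ) • Y)).det = 1 := by rw [zero_smul, NormedSpace.exp_zero, Matrix.det_one]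
  have hz : HasDerivAt (fun z : ℂ ↦ z ^ a) ((a : ℂ) * (NormedSpace.exp ((0 : ℝ) • Y)).det ^ (a - 1))
      ((NormedSpace.exp ((0 : ℝ) • Y)).det) := hasDerivAt_zpow a _ (Or.inl (by rw [h0]; exact one_ne_zero))
  have h := hz.comp 0 hdet
  rw [h0, one_zpow, mul_one] at h
  exact h

/-- **The derivative of the `K`-type coefficients along `exp tX`, `X ∈ 𝔨`**:
`d/dt|₀ upqKTypeCoeff n a b (expK (tX)) i j = (a · tr X₁₁ + b · (X₂₂)₀₀) δ_{ij} + dSymPowerMat n X₁₁ i j`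
— `det (exp tX₁₁)^a (exp tX₂₂)₀₀^b` has derivative `a tr X₁₁ + b (X₂₂)₀₀` and value `1` at `0`, `Sym^n (exp tX₁₁)` has
derivative `dSym^n (X₁₁)` (★ β1) and value `1`. This is the matrix-coefficient form of `IsGKModule.hasWeakDeriv` for the
`K`-types `det^a ⊗ u^b ⊗ Sym^n`. [cite: BorelWallach2000, 0 §2.5] [cite: Kovacevic2021, §6] -/
theorem hasDerivAt_upqKTypeCoeff_expK (n : ℕ) (a b : ℤ) (X : (uFormGroup (Fin 2) (Fin 1)).compactLie) (i j : Fin (n + 1)) :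
    HasDerivAt (fun t : ℝ ↦ upqKTypeCoeff n a b ((uFormGroup (Fin 2) (Fin 1)).expK (t • X)) i j)
      (((a : ℂ) * ((X : Matrix (Fin 2 ⊕ Fin 1) (Fin 2 ⊕ Fin 1) ℂ).toBlocks₁₁).trace +
          (b : ℂ) * (X : Matrix (Fin 2 ⊕ Fin 1) (Fin 2 ⊕ Fin 1) ℂ).toBlocks₂₂ 0 0) * (if i = j then 1 else 0) +
        dSymPowerMat n ((X : Matrix (Fin 2 ⊕ Fin 1) (Fin 2 ⊕ Fin 1) ℂ).toBlocks₁₁) i j) 0 := by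
  set X₁ := (X : Matrix (Fin 2 ⊕ Fin 1) (Fin 2 ⊕ Fin 1) ℂ).toBlocks₁₁ with hX₁
  set X₂ := (X : Matrix (Fin 2 ⊕ Fin 1) (Fin 2 ⊕ Fin 1) ℂ).toBlocks₂₂ with hX₂
  -- the coefficient along the one-parameter group, in blocks
  have hfun : (fun t : ℝ ↦ upqKTypeCoeff n a b ((uFormGroup (Fin 2) (Fin 1)).expK (t • X)) i j) =
      fun t : ℝ ↦ ((NormedSpace.exp (t • X₁)).det ^ a * (NormedSpace.exp (t • X₂)).det ^ b) *
        symPowerMat n (NormedSpace.exp (t • X₁)) i j := by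
    funext t
    rw [upqKTypeCoeff_apply, coe_upqKBlock₁_expK_smul, coe_upqKBlock₂_expK_smul, Matrix.det_fin_one]
  rw [hfun]
  -- the three factors
  have h1 := hasDerivAt_det_exp_smul_zpow X₁ a
  have h2 := hasDerivAt_det_exp_smul_zpow X₂ b
  have h3 := hasDerivAt_symPowerMat_exp_apply n X₁ i j
  have h := (h1.fun_mul h2).fun_mul h3
  refine h.congr_deriv ?_
  simp only [zero_smul, NormedSpace.exp_zero, Matrix.det_one, one_zpow, mul_one, one_mul, symPowerMat_one,
    Matrix.trace_fin_one, Matrix.one_apply]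

/-- The same derivative with the Kronecker delta spelt `Matrix.one_apply`-free: diagonal entries.
[cite: BorelWallach2000, 0 §2.5] -/
theorem hasDerivAt_upqKTypeCoeff_expK_diag (n : ℕ) (a b : ℤ) (X : (uFormGroup (Fin 2) (Fin 1)).compactLie) (i : Fin (n + 1)) :
    HasDerivAt (fun t : ℝ ↦ upqKTypeCoeff n a b ((uFormGroup (Fin 2) (Fin 1)).expK (t • X)) i i)
      ((a : ℂ) * ((X : Matrix (Fin 2 ⊕ Fin 1) (Fin 2 ⊕ Fin 1) ℂ).toBlocks₁₁).trace +
          (b : ℂ) * (X : Matrix (Fin 2 ⊕ Fin 1) (Fin 2 ⊕ Fin 1) ℂ).toBlocks₂₂ 0 0 +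
        dSymPowerMat n ((X : Matrix (Fin 2 ⊕ Fin 1) (Fin 2 ⊕ Fin 1) ℂ).toBlocks₁₁) i i) 0 := by
  have h := hasDerivAt_upqKTypeCoeff_expK n a b X i i
  rw [if_pos rfl, mul_one] at h
  exact h

/-- Off-diagonal entries: only `dSym^n` contributes. [cite: BorelWallach2000, 0 §2.5] -/
theorem hasDerivAt_upqKTypeCoeff_expK_offDiag (n : ℕ) (a b : ℤ) (X : (uFormGroup (Fin 2) (Fin 1)).compactLie)
    {i j : Fin (n + 1)} (hij : i ≠ j) :
    HasDerivAt (fun t : ℝ ↦ upqKTypeCoeff n a b ((uFormGroup (Fin 2) (Fin 1)).expK (t • X)) i j)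
      (dSymPowerMat n ((X : Matrix (Fin 2 ⊕ Fin 1) (Fin 2 ⊕ Fin 1) ℂ).toBlocks₁₁) i j) 0 := by
  have h := hasDerivAt_upqKTypeCoeff_expK n a b X i j
  rw [if_neg hij, mul_zero, zero_add] at h
  exact h

/-- The value at `t = 0`: `upqKTypeCoeff n a b (expK 0) = 1`. [cite: BorelWallach2000, 0 §2.5] -/
theorem upqKTypeCoeff_expK_zero_smul (n : ℕ) (a b : ℤ) (X : (uFormGroup (Fin 2) (Fin 1)).compactLie) :
    upqKTypeCoeff n a b ((uFormGroup (Fin 2) (Fin 1)).expK ((0 : ℝ) • X)) = 1 := by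
  rw [RealMatrixGroup.expK_zero_smul, upqKTypeCoeff_one]

end Deriv

end Summit.HodgeConjecture.HodgeConjecture.Cruxes.H413.F0P3bKTypeCalculus
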